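import Literature.AlgebraicGeometry.AbelianSchemes.LevelStructureSpreadStages
import Literature.AlgebraicGeometry.AbelianSchemes.PolarizedAbelianSchemeWithLevelBaseChangeCancel
import HarnessLib

/-!
# A level structure on the generic fibre of an abelian scheme spreads out to a stage `D(t)`
# (EGA IV₃ §8 limit formalism + MFK Prop. 7.3 step (IV); organ (SP2) of the MOD programme's SPREAD door)

Topic `Literature/AlgebraicGeometry/AbelianSchemes`; namespace `Literature.AlgebraicGeometry.AbelianSchemes.AbelianSchemeOver`.
THEOREMS ONLY (no definition, no named fact, no instance, no notation, no `sorry`; net Literature debt 0).  Cell `hodgecm-mathlib`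
(D-0151), programme F0/P6 «MOD», SPREAD door (LEAD M-17m/M-17n; REP-S census `CENSUS-REP-S-SpreadDoor` §2 row `lvl :597`, §4 «SP2 level
spread»), FILE 2 of 2 over ★ `LevelStructureSpreadStages` (§0–§5).  `--supports stmt-HodgeConjecture-24832`, count-neutral.  HONEST LABEL:
HC_CM is proved only modulo the 2 remaining named inputs (hLiu418 24832, h413 24833) until rung 0 closes; this file discharges none of them.

THE STATEMENT.  `A` a ring, `S ⊆ A` a submonoid, `B = A_S`; `P → Spec A` quasi-compact, quasi-separated, locally of finite presentation;
`𝒜 → P` an abelian scheme of relative dimension `g` (★ `AbelianSchemeOver`, ★ `IsOfRelDim`); `N ≠ 0` invertible in `B`.  A level-`N` structure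
`φ` (★ MFK `LevelStructure g N`: `2g` sections, `N`-torsion, a basis of the `N`-torsion on every geometric fibre) on the GENERIC FIBRE
`𝒜 ×_P (P ⊗ Spec A_S)` spreads to a STAGE: for some `t ∈ S` there is a level-`N` structure `ψ` on `𝒜 ×_P P|_{D(t)}` of which `φ` is the
pull-back along the cone leg `P ⊗ Spec A_S → P|_{D(t)}` in the sense of the moduli functor's relation ★ `LevelStructure.IsBaseChangeVia`
(cartesian square of group schemes + `σ_{φ,i} ≫ G = leg ≫ σ_{ψ,i}`), `G` commuting with the projections to `𝒜`:
* **`LevelStructure.exists_stage_of_generic`** — with the stage carrier an (iterated, chosen) pull-back `𝒞` of `𝒜`, `𝒞.IsBaseChangeVia 𝒜 pr H`;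
* **`LevelStructure.exists_stage_baseChange_of_generic`** — on the tree's chosen base change `𝒜.baseChange pr` (moved along the isomorphism of
  group schemes `𝒞 ≅ 𝒜 ×_P P|_{D(t)}`, ★ `exists_iso_of_isBaseChangeVia_id`, ★ `LevelStructure.exists_comp_of_iso`).
In the MOD application: `A = 𝓞_{Fᵢ}[1∕m₀]` (or `𝓞 F`), `S = A ∖ 0`, `B = Fᵢ`, `P` = the spread `𝓜` of the record curve, `𝒜` = the spread of the
char-0 PEL family ((SP1)); the bad stages are absorbed by the cofinite set `S_M` (REP-S §1).

PROOF (all levers ★ / Mathlib, FILE 1): the `2g` sections spread as `P`-morphisms to a stage and are packaged as sections `τᵢ`, and `φ` is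
re-read as the pull-back of the `τᵢ` (§1–§2); their `N`-torsion holds at a finer stage (§3); below the stage where `N` becomes invertible
(§5) the injectivity of `a ↦ τ^a` on geometric fibres holds at a finer stage (§4, open locus + Stacks 01Z3, no density hypothesis); there an
injective `N`-torsion family IS a level structure (★ `exists_levelStructure_of_injective`, `#A_s[N](Ω) = N^{2g}`); the relation by
cancellation of pull-back squares (★ `AbelianSchemeOver.isBaseChangeVia_of_comp`, ★ `IsBaseChangeVia.exists_comp_eq_of_comp`).  Between
stages the level structure is carried along the comparison isomorphisms ★ `baseChangeCompGrpIso` by ★ `LevelStructure.exists_baseChange_baseChange_iff`.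

## References
* [EGAIV3] A. Grothendieck, J. Dieudonné, EGA IV₃ (Publ. Math. IHÉS 28, 1966), Thm. 8.8.2, §8.3, Thm. 8.10.5.
* [GortzWedhorn2020] U. Görtz, T. Wedhorn, *Algebraic Geometry I*, 2nd ed. (2020), Thm. 10.57 p. 264, Cor. 10.64 p. 267, Section (4.7) pp. 107–108.
* [MumfordFogartyKirwan1994] D. Mumford, J. Fogarty, F. Kirwan, *Geometric Invariant Theory*, 3rd ed. (1994), Ch. 7 §2 Definitions 7.1–7.3
  (p. 129), Proposition 7.3, proof, step (IV) (pp. 133–134).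
* [StacksProject] The Stacks Project, Tags 01ZC, 01Z3.
-/

set_option autoImplicit false

noncomputable section

universe u

open CategoryTheory CategoryTheory.Limits AlgebraicGeometry MonoidalCategory CartesianMonoidalCategory
open scoped MonObj

namespace Literature.AlgebraicGeometry.AbelianSchemes

namespace AbelianSchemeOver

open Literature.AlgebraicGeometry.Motives (SchemeOver specOver)
open Literature.AlgebraicGeometry.Limits Literature.AlgebraicGeometry.Limits.LocApprox

set_option backward.isDefEq.respectTransparency false

variable {A : Type u} [CommRing A] {S : Submonoid A} {B : Type u} [CommRing B] [Algebra A B] [IsLocalization S B]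
variable {P : SchemeOver A}

/-! ### HEAD — a level structure on the generic fibre spreads to a stage -/

section Head

variable (B)
variable [QuasiCompact P.hom] [QuasiSeparated P.hom] [LocallyOfFinitePresentation P.hom] (𝒜 : AbelianSchemeOver P.left)

/-- **SPREAD OF A LEVEL STRUCTURE (EGA IV₃ §8 + MFK Prop. 7.3 (IV)).**  `P → Spec A` quasi-compact, quasi-separated,
locally of finite presentation; `𝒜 → P` an abelian scheme of relative dimension `g`; `B = A_S` with `N ≠ 0` invertible in
`B`.  A level-`N` structure `φ` on the generic fibre `𝒜 ×_P (P ⊗ Spec A_S)` spreads: for some `t ∈ S` there are an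
abelian scheme `𝒞` over the stage `P|_{D(t)} = P ⊗ Spec A[1∕t]` which is the base change of `𝒜` along the stage projection
(`𝒞.IsBaseChangeVia 𝒜 pr H`, as group schemes; `𝒞` is an iterated chosen pull-back of `𝒜`), a level-`N` structure `ψ` on
`𝒞`, and a morphism `G` over `H` through which `φ` IS the pull-back of `ψ` along the cone leg
`P ⊗ Spec A_S → P|_{D(t)}` in the sense of the moduli functor (★ `LevelStructure.IsBaseChangeVia`: cartesian square of group
schemes + `σ_{φ,i} ≫ G = leg ≫ σ_{ψ,i}`).  Proof: the `2g` sections spread as morphisms (§1) and are packaged as sections at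
a stage (§2, where `φ` is re-read as the pull-back of the stage sections); `N`-torsion holds at a finer stage (§3);
injectivity on geometric fibres at a finer stage (§4); below the stage where `N` becomes invertible (§5) injective
`N`-torsion families are level structures (★ `exists_levelStructure_of_injective`); the relation by cancellation of pull-back
squares (★ `isBaseChangeVia_of_comp`).
[cite: MumfordFogartyKirwan1994, Ch. 7 §2 Definitions 7.1–7.2 (p. 129), Proposition 7.3 step (IV) (pp. 133–134)]
[cite: GortzWedhorn2020, Thm. 10.57 / Cor. 10.64 (pp. 264–267)] [cite: StacksProject, Tags 01ZC, 01Z3] -/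
theorem LevelStructure.exists_stage_of_generic {g N : ℕ} [NeZero N] (hg : 𝒜.IsOfRelDim g) (hN : IsUnit ((N : ℕ) : B))
    (φ : LevelStructure g N (𝒜.baseChange (fst P (specOver A B)).left)) :
    ∃ (t : Idx S) (𝒞 : AbelianSchemeOver (P ⊗ (baseDiagram S).obj t).left) (H : 𝒞.X.left ⟶ 𝒜.X.left)
      (ψ : LevelStructure g N 𝒞) (G : (𝒜.baseChange (fst P (specOver A B)).left).X.left ⟶ 𝒞.X.left),
      𝒞.IsBaseChangeVia 𝒜 (fst P ((baseDiagram S).obj t)).left H ∧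
      G ≫ H = pullback.fst 𝒜.X.hom (fst P (specOver A B)).left ∧
      φ.IsBaseChangeVia ψ (P ◁ (baseCone S B).π.app t).left G := by
  classical
  -- notation
  have hφsec' : ∀ i, (φ.σ i).left ≫ (𝒜.baseChange (fst P (specOver A B)).left).X.hom = 𝟙 _ := fun i => by
    have hw := Over.w (φ.σ i); rw [Over.tensorUnit_hom] at hw; exact hw
  have hφsec : ∀ i, (φ.σ i).left ≫ pullback.snd 𝒜.X.hom (fst P (specOver A B)).left = 𝟙 _ := hφsec'
  -- §5: the stage below which `N` is invertible
  obtain ⟨tN, htN⟩ := exists_idx_forall_isUnit_algebraMap_loc (S := S) (B := B) N hN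
  -- §1: the sections as morphisms spread to a stage `t₁`
  obtain ⟨t₁, ut, hut⟩ := 𝒜.exists_stage_homs_of_generic (S := S) B
    (fun i => (φ.σ i).left ≫ pullback.fst 𝒜.X.hom (fst P (specOver A B)).left) (fun i => by
      rw [Category.assoc, pullback.condition, reassoc_of% (hφsec i)])
  -- §2: packaged as sections `τ₁` of `𝒜₁ := 𝒜 ×_P P|_{D(t₁)}`, and `φ` re-read on `𝒜₁ ×_{t₁} (generic fibre)`
  obtain ⟨τ₁, hτ₁⟩ := 𝒜.exists_sections_left_comp_fst_eq (fst P ((baseDiagram S).obj t₁)).left ut (fun i => (hut i).1)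
  obtain ⟨φ₁, hφ₁⟩ := LevelStructure.exists_baseChange_baseChange_of_left_comp_fst 𝒜 (fst P ((baseDiagram S).obj t₁)).left
    (P ◁ (baseCone S B).π.app t₁).left (whiskerLeft_π_left_comp_fst_left t₁).symm φ τ₁ (fun i => by
      rw [hτ₁ i, (hut i).2])
  -- §3: `N`-torsion at a finer stage `t₂`, refined below `tN`
  have hN₁ : ∀ i, (𝒜.baseChange (fst P ((baseDiagram S).obj t₁)).left).sectionBaseChange
      (P ◁ (baseCone S B).π.app t₁).left (τ₁ i) ^ N = 1 := fun i => by rw [← hφ₁ i]; exact φ₁.pow_σ i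
  obtain ⟨t₂', f₁₂', hN₂'⟩ := exists_stage_sectionBaseChange_pow_eq_one B _ τ₁ N hN₁
  obtain ⟨t₂, ht₂⟩ := IsCofiltered.inf_objs_exists ({t₂', tN} : Finset (Idx S))
  have k₂ : t₂ ⟶ t₂' := (ht₂ (by simp)).some
  have k₂N : t₂ ⟶ tN := (ht₂ (by simp)).some
  let f₁₂ : t₂ ⟶ t₁ := k₂ ≫ f₁₂'
  -- the carriers at stage `t₂`
  let 𝒜₁ := 𝒜.baseChange (fst P ((baseDiagram S).obj t₁)).left
  let ρ₁₂ := (P ◁ (baseDiagram S).map f₁₂).left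
  have hN₂ : ∀ i, 𝒜₁.sectionBaseChange ρ₁₂ (τ₁ i) ^ N = 1 := fun i => by
    rw [𝒜₁.sectionBaseChange_pow_eq_one_iff_comp_left_eq ρ₁₂ (τ₁ i) N]
    change (P ◁ (baseDiagram S).map (k₂ ≫ f₁₂')).left ≫ _ = (P ◁ (baseDiagram S).map (k₂ ≫ f₁₂')).left ≫ _
    rw [← whiskerLeft_map_left_comp_map_left k₂ f₁₂', Category.assoc, Category.assoc,
      (𝒜₁.sectionBaseChange_pow_eq_one_iff_comp_left_eq _ (τ₁ i) N).1 (hN₂' i)]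
  let 𝒜₂ := 𝒜₁.baseChange ρ₁₂
  let τ₂ : Fin g ⊕ Fin g → 𝒜₂.Sections := fun i => 𝒜₁.sectionBaseChange ρ₁₂ (τ₁ i)
  -- `φ` re-read on `𝒜₂ ×_{t₂} (generic fibre)`
  have hb₂ : (P ◁ (baseCone S B).π.app t₂).left ≫ ρ₁₂ = (P ◁ (baseCone S B).π.app t₁).left :=
    whiskerLeft_π_left_comp_map_left f₁₂
  obtain ⟨φ₂, hφ₂⟩ := (LevelStructure.exists_baseChange_baseChange_iff 𝒜₁ hb₂ τ₁).2 ⟨φ₁, hφ₁⟩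
  -- §4: injectivity at a finer stage `t₃`
  have hinj₂ : ∀ ⦃Ω : Type u⦄ [Field Ω] [IsAlgClosed Ω] (x : Spec (.of Ω) ⟶ (P ⊗ specOver A B).left),
      Function.Injective fun a : Fin g ⊕ Fin g → ZMod N =>
        (𝒜₂.baseChange (P ◁ (baseCone S B).π.app t₂).left).restrict x
          ((𝒜₂.baseChange (P ◁ (baseCone S B).π.app t₂).left).sectionPow
            (fun i => 𝒜₂.sectionBaseChange (P ◁ (baseCone S B).π.app t₂).left (τ₂ i)) a) := by
    intro Ω _ _ x
    have hσ : (fun i => 𝒜₂.sectionBaseChange (P ◁ (baseCone S B).π.app t₂).left (τ₂ i)) = φ₂.σ :=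
      funext fun i => (hφ₂ i).symm
    rw [hσ]
    exact φ₂.basis_injective x
  obtain ⟨t₃, f₂₃, hinj₃⟩ := exists_stage_forall_injective B 𝒜₂ τ₂ hinj₂
  let ρ₂₃ := (P ◁ (baseDiagram S).map f₂₃).left
  let 𝒜₃ := 𝒜₂.baseChange ρ₂₃
  let τ₃ : Fin g ⊕ Fin g → 𝒜₃.Sections := fun i => 𝒜₂.sectionBaseChange ρ₂₃ (τ₂ i)
  have hN₃ : ∀ i, τ₃ i ^ N = 1 := fun i => by
    change 𝒜₂.sectionBaseChange ρ₂₃ (τ₂ i) ^ N = 1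
    rw [← map_pow, hN₂ i, map_one]
  -- `N` is invertible on `P|_{D(t₃)}` (`t₃ ≤ tN`)
  have ht₃N : t₃ ≤ tN := leOfHom (f₂₃ ≫ k₂N)
  have hn₃ : ∀ y : (P ⊗ (baseDiagram S).obj t₃).left, (N : ((P ⊗ (baseDiagram S).obj t₃).left).residueField y) ≠ 0 :=
    natCast_residueField_ne_zero_of_isUnit_loc N (htN t₃ ht₃N) _ (snd P ((baseDiagram S).obj t₃)).left
  have hg₃ : 𝒜₃.IsOfRelDim g := ((hg.baseChange _).baseChange _).baseChange _
  -- §4 of ★ `LevelStructureLocus`: basis for free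
  obtain ⟨ψ, hψ⟩ := 𝒜₃.exists_levelStructure_of_injective hg₃ hn₃ τ₃ hN₃ hinj₃
  -- the relations
  have h01 : 𝒜₁.IsBaseChangeVia 𝒜 (fst P ((baseDiagram S).obj t₁)).left (pullback.fst _ _) :=
    𝒜.baseChange_isBaseChangeVia _
  have h12 : 𝒜₂.IsBaseChangeVia 𝒜₁ ρ₁₂ (pullback.fst _ _) := 𝒜₁.baseChange_isBaseChangeVia _
  have h23 : 𝒜₃.IsBaseChangeVia 𝒜₂ ρ₂₃ (pullback.fst _ _) := 𝒜₂.baseChange_isBaseChangeVia _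
  have h𝒞 : 𝒜₃.IsBaseChangeVia 𝒜 (fst P ((baseDiagram S).obj t₃)).left
      ((pullback.fst _ _ ≫ pullback.fst _ _) ≫ pullback.fst _ _) := by
    have h := (h23.trans h12).trans h01
    have e : (ρ₂₃ ≫ ρ₁₂) ≫ (fst P ((baseDiagram S).obj t₁)).left = (fst P ((baseDiagram S).obj t₃)).left := by
      change ((P ◁ (baseDiagram S).map f₂₃).left ≫ (P ◁ (baseDiagram S).map f₁₂).left) ≫ _ = _
      rw [whiskerLeft_map_left_comp_map_left, whiskerLeft_map_left_comp_fst_left]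
    rwa [e] at h
  -- the generic fibre as a base change along the cone leg at `t₃`
  have hB : (𝒜.baseChange (fst P (specOver A B)).left).IsBaseChangeVia 𝒜
      ((P ◁ (baseCone S B).π.app t₃).left ≫ (fst P ((baseDiagram S).obj t₃)).left) (pullback.fst _ _) := by
    rw [whiskerLeft_π_left_comp_fst_left]
    exact 𝒜.baseChange_isBaseChangeVia _
  obtain ⟨m, hmG, hmπ⟩ := IsBaseChangeVia.exists_comp_eq_of_comp hB h𝒞
  refine ⟨t₃, 𝒜₃, (pullback.fst _ _ ≫ pullback.fst _ _) ≫ pullback.fst _ _, ψ, m, h𝒞, hmG,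
    AbelianSchemeOver.isBaseChangeVia_of_comp hB h𝒞 m hmG hmπ, fun i => ?_⟩
  -- the section clause, tested inside the cartesian square `𝒜₃ = 𝒜 ×_P P|_{D(t₃)}`
  obtain ⟨-, hpb, -, -⟩ := h𝒞
  apply hpb.hom_ext
  · rw [Category.assoc, hmG, hψ, Category.assoc]
    change _ = _ ≫ (𝒜₂.sectionBaseChange ρ₂₃ (τ₂ i)).left ≫ (pullback.fst _ _ ≫ pullback.fst _ _) ≫ pullback.fst _ _
    rw [Category.assoc, reassoc_of% (𝒜₂.sectionBaseChange_left_comp_fst ρ₂₃ (τ₂ i))]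
    change _ = _ ≫ ρ₂₃ ≫ (𝒜₁.sectionBaseChange ρ₁₂ (τ₁ i)).left ≫ pullback.fst _ _ ≫ pullback.fst _ _
    rw [reassoc_of% (𝒜₁.sectionBaseChange_left_comp_fst ρ₁₂ (τ₁ i)), hτ₁ i, ← (hut i).2, ← hb₂,
      ← whiskerLeft_π_left_comp_map_left f₂₃]
    simp only [Category.assoc]
    rfl
  · have h3 : (ψ.σ i).left ≫ 𝒜₃.X.hom = 𝟙 _ := by
      have hw := Over.w (ψ.σ i); rw [Over.tensorUnit_hom] at hw; exact hw
    rw [Category.assoc, hmπ, reassoc_of% (hφsec' i), Category.assoc, h3]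
    exact (Category.comp_id _).symm


/-- **SPREAD OF A LEVEL STRUCTURE — on the chosen pull-back `𝒜 ×_P P|_{D(t)}`.**  Same as
`LevelStructure.exists_stage_of_generic`, with the level structure moved onto the tree's chosen base change
`𝒜.baseChange pr` along the isomorphism of group schemes `𝒞 ≅ 𝒜 ×_P P|_{D(t)}` (cancellation of pull-back squares along
`𝟙`, ★ `exists_iso_of_isBaseChangeVia_id`, ★ `LevelStructure.exists_comp_of_iso`); `G` commutes with the projections to `𝒜`.
[cite: MumfordFogartyKirwan1994, Ch. 7 §2 Definitions 7.1–7.3 (p. 129), Proposition 7.3 step (IV) (pp. 133–134)]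
[cite: GortzWedhorn2020, Thm. 10.57 / Cor. 10.64 (pp. 264–267)] -/
theorem LevelStructure.exists_stage_baseChange_of_generic {g N : ℕ} [NeZero N] (hg : 𝒜.IsOfRelDim g)
    (hN : IsUnit ((N : ℕ) : B)) (φ : LevelStructure g N (𝒜.baseChange (fst P (specOver A B)).left)) :
    ∃ (t : Idx S) (ψ : LevelStructure g N (𝒜.baseChange (fst P ((baseDiagram S).obj t)).left))
      (G : (𝒜.baseChange (fst P (specOver A B)).left).X.left ⟶ (𝒜.baseChange (fst P ((baseDiagram S).obj t)).left).X.left),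
      G ≫ pullback.fst 𝒜.X.hom (fst P ((baseDiagram S).obj t)).left = pullback.fst 𝒜.X.hom (fst P (specOver A B)).left ∧
      φ.IsBaseChangeVia ψ (P ◁ (baseCone S B).π.app t).left G := by
  obtain ⟨t, 𝒞, H, ψ, G, h𝒞, hGH, hφ⟩ := LevelStructure.exists_stage_of_generic (S := S) B 𝒜 hg hN φ
  -- `𝒞 ≅ 𝒜 ×_P P|_{D(t)}` as group schemes, by cancellation along `𝟙`
  have h𝒞' : 𝒞.IsBaseChangeVia 𝒜 (𝟙 _ ≫ (fst P ((baseDiagram S).obj t)).left) H := by rwa [Category.id_comp]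
  have hA : (𝒜.baseChange (fst P ((baseDiagram S).obj t)).left).IsBaseChangeVia 𝒜 (fst P ((baseDiagram S).obj t)).left
      (pullback.fst _ _) := 𝒜.baseChange_isBaseChangeVia _
  obtain ⟨m, hmH, hmπ⟩ := IsBaseChangeVia.exists_comp_eq_of_comp h𝒞' hA
  have hm := AbelianSchemeOver.isBaseChangeVia_of_comp h𝒞' hA m hmH hmπ
  obtain ⟨e, he, hemon⟩ := exists_iso_of_isBaseChangeVia_id hm
  haveI := hemon
  obtain ⟨ψ', hψ'⟩ := LevelStructure.exists_comp_of_iso e ψ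
  refine ⟨t, ψ', G ≫ m, ?_, ?_, fun i => ?_⟩
  · rw [Category.assoc, hmH, hGH]
  · have h := hφ.1.trans hm
    rwa [Category.comp_id] at h
  · rw [hψ' i, Over.comp_left, he, reassoc_of% (hφ.2 i)]

end Head

end AbelianSchemeOver

end Literature.AlgebraicGeometry.AbelianSchemes

end
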